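import Literature.NumberTheory.EllipticCurves.SelmerTorsionRestriction
import Literature.NumberTheory.EllipticCurves.SelmerLocalConditionGoodReductionProofs
import Literature.NumberTheory.EllipticCurves.LocalH1TateDualityLangTateProofs
import Literature.NumberTheory.EllipticCurves.H1UnramifiedFinite
import Literature.NumberTheory.EllipticCurves.PeriodIndexCorestrictionLocal
import Literature.NumberTheory.GaloisRepresentations.AbsIntegersEquiv
import HarnessLib

/-!
# Route `GenusKolyvaginAtTwo`, LINE 6, KEY crux Q3 (`EquivariantKolyvaginExactAtTwo`, inner statement of
# stmt-BirchSwinnertonDyer-22137): the Selmer local condition DESCENDS along an extension `L/F` at a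
# good place `v ∤ n` which is unramified in `L` — McCallum's Lemma 4.3 transfers from `K` to `ℚ`

Helper (seat `bsd-line-gk2-p3` g12; `--supports` the crux, closes nothing; route-independent). In the
eigen/`ℚ` architecture of Q3 (memos Q3-ARCH v2, Q3-KERNEL-EIGEN v2 on stmt-24882; gk2-p2's
`KolyvaginDescent.(Visible)SplitHypothesesM`, field `c_mem_loc`) McCallum's Lemma 4.3 — *"`c_M(n)_v`
lies in the image of `E(K_v)/p^M` for `v ∤ n`"* ([McCallumLMS1991] §4 Lemma 4.3; [GrossLMS1991] Prop. 6.2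
(1)) — is known OVER `K` and must be read OVER `ℚ` for the descended Kolyvagin classes of `E` and of its
twin `E^{d_K}`. The restriction `res : H¹(F, E[n]) → H¹(L, E_L[n])` (`resTorsion`) always carries the
Selmer local condition at `v` into the one at `w ∣ v`; this file proves the CONVERSE at a place `v ∤ n`
of good reduction which is unramified in `L`:

* `intCast_notMem_of_liesOver` — `v ∤ n ⟹ w ∤ n` for `w ∣ v` (bookkeeping);
* `mem_selmerLocalKer_of_resTorsion_mem_of_inertia_le` — **if `res x` satisfies the Selmer condition
  of `E_L` at `w`, then `x` satisfies the Selmer condition of `E` at `v`**, for `x ∈ H¹(F, E[n])`, `v ∤ n`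
  of good reduction, `w ∣ v`, and a prime `𝔔` of `\bar ℤ_L` above `w` whose contracted prime
  `𝔓 = 𝔔 ∩ \bar ℤ_F` has inertia group `I_𝔓 ≤ res(Γ_L)` (the Galois form of "`v` is unramified in `L`";
  for `L/F` Galois it says that `I_𝔓` fixes `L`). Proof: at a good place `v ∤ n` the Selmer condition is
  "unramified at `𝔓`" (Gross (7.1)/(7.4), tree `selmerLocalKer_eq_unramifiedKer`, downstairs AND upstairs —
  good reduction is stable under base change, `hasGoodReductionAt_baseChange_of_hasGoodReductionAt`);
  `I_𝔔 = res⁻¹(I_𝔓)` (`comap_inertia_comap_absIntegersMap`), so with `I_𝔓 ≤ res(Γ_L)` every `σ ∈ I_𝔓`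
  is `res τ` with `τ ∈ I_𝔔`, and a cocycle of `x` which is a coboundary on `I_𝔔` after transport along
  the `Γ_L`-equivariant bijection `E[n](F̄) ≃ E_L[n](L̄)` (`torsionBaseChangeEquiv`) is a coboundary on
  `I_𝔓`.

Reading for the crux: for `F = ℚ`, `L = K` the Heegner field and `n = 2^M`, this is the transfer
`ℚ ← K` of Lemma 4.3 at every ODD good place `v ∤ d_K` (there `I_𝔓` fixes `K = ℚ(√d_K)`); the places
`v ∣ d_K` (ramified: obstruction group `H¹(Gal(K_w/ℚ_v), E(K_w))` of order `#E(ℚ_v)[2]`) and `v = 2`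
(`v ∣ n`) are NOT covered here. Split places need no hypothesis beyond `I_𝔓 ≤ res(Γ_L)` either.

THEOREMS ONLY (no definition, no named fact, no `sorry`, standard axioms). BSD is not proved by any of this.

References: [McCallumLMS1991] §4 Lemma 4.3; [GrossLMS1991] Prop. 6.2 (1), §7 (7.1), (7.4);
[SilvermanAEC2009] Cor. X.4.4, VIII §2; [MilneADT2006] I Prop. 3.8; [NeukirchANT1999] I §9 (9.4)–(9.6)
(inertia groups in towers); [SerreLocalFields1979] I §7 Prop. 22.
-/

set_option autoImplicit false
set_option linter.dupNamespace false -- tree convention: `Summit.BirchSwinnertonDyer.BirchSwinnertonDyer.Theorems` (summit = sub-problem)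

noncomputable section

open scoped Classical

universe u

namespace Summit.BirchSwinnertonDyer.BirchSwinnertonDyer.Theorems.GenusExact.SelmerDescent

open WeierstrassCurve NumberField IsDedekindDomain Field
open Literature.NumberTheory.EllipticCurves Literature.NumberTheory.GaloisRepresentations

variable {F : Type u} [Field F] [NumberField F] (W : WeierstrassCurve F) [W.IsElliptic]
variable (L : Type u) [Field L] [NumberField L] [Algebra F L]
variable (v : HeightOneSpectrum (𝓞 F)) (w : HeightOneSpectrum (𝓞 L)) [w.asIdeal.LiesOver v.asIdeal]

omit [NumberField F] [NumberField L] in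
/-- `v ∤ n ⟹ w ∤ n` for a place `w` of `L` above the place `v` of `F` and `n : ℤ`. [folklore] -/
theorem intCast_notMem_of_liesOver {n : ℤ} (hn : (n : 𝓞 F) ∉ v.asIdeal) : (n : 𝓞 L) ∉ w.asIdeal := by
  intro h
  apply hn
  have hcast : (n : 𝓞 L) = algebraMap (𝓞 F) (𝓞 L) n := by simp
  rw [hcast, ← Ideal.mem_comap, ← Ideal.under_def] at h
  rwa [Ideal.LiesOver.over (P := w.asIdeal) (p := v.asIdeal)]

/-- **The Selmer local condition descends along `L/F` at a good place `v ∤ n` unramified in `L`**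
(McCallum's Lemma 4.3 read over the smaller field). Let `E = W/F` be elliptic, `n : ℤ`, `v` a finite
place of `F` of good reduction with `v ∤ n`, `w` a place of `L` above `v`, `𝔔` a prime of `\bar ℤ_L`
above `w`, and suppose the inertia group of the contracted prime `𝔓 = 𝔔 ∩ \bar ℤ_F` satisfies
`I_𝔓 ≤ res(Γ_L)` (`v` unramified in `L`, Galois form). If the restriction `res x ∈ H¹(L, E_L[n])` of
`x ∈ H¹(F, E[n])` satisfies the Selmer local condition of `E_L` at `w`, then `x` satisfies the Selmer
local condition of `E` at `v`. (Both conditions are "unramified", Gross (7.1)/(7.4); `I_𝔔 = res⁻¹ I_𝔓`.)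
[cite: McCallumLMS1991, §4 Lemma 4.3] [cite: GrossLMS1991, Prop. 6.2 (1) and §7 (7.1), (7.4)]
[cite: NeukirchANT1999, Ch. I §9 Prop. (9.4)–(9.6)] -/
theorem mem_selmerLocalKer_of_resTorsion_mem_of_inertia_le (n : ℤ)
    (hgood : W.HasGoodReductionAt v) (hn : (n : 𝓞 F) ∉ v.asIdeal)
    {𝔔 : Ideal (absIntegers (𝓞 L) L)} (h𝔔 : 𝔔 ∈ w.primesAbove)
    (hI : (𝔔.comap (absIntegersMap F L)).inertia (absoluteGaloisGroup F) ≤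
      (absGaloisRestrict F L).toMonoidHom.range)
    {x : galH1Torsion W n}
    (hx : resTorsion W L n x ∈ selmerLocalKer (W.baseChange L) (w.adicCompletion L) n) :
    x ∈ selmerLocalKer W (v.adicCompletion F) n := by
  -- the contracted prime lies above `v`; good reduction and `w ∤ n` upstairs
  have hwv : w.asIdeal.under (𝓞 F) = v.asIdeal :=
    (Ideal.LiesOver.over (P := w.asIdeal) (p := v.asIdeal)).symm
  have h𝔓 : 𝔔.comap (absIntegersMap F L) ∈ v.primesAbove :=
    comap_absIntegersMap_mem_primesAbove hwv h𝔔
  have hgoodL : (W.baseChange L).HasGoodReductionAt w :=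
    hasGoodReductionAt_baseChange_of_hasGoodReductionAt W L v w hgood
  have hnL : (n : 𝓞 L) ∉ w.asIdeal := intCast_notMem_of_liesOver L v w hn
  -- both Selmer conditions are "unramified"
  rw [W.selmerLocalKer_eq_unramifiedKer hgood hn h𝔓]
  rw [(W.baseChange L).selmerLocalKer_eq_unramifiedKer hgoodL hnL h𝔔] at hx
  -- cocycle level
  obtain ⟨φ, rfl⟩ :=
    oneCocycleClass_surjective (discreteTopRep (absoluteGaloisGroup F) (geomTorsion W n)) x
  rw [unramifiedKer, oneCocycleClass_mem_subgroupResKer_iff]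
  rw [resTorsion, resH1Hom_oneCocycleClass, unramifiedKer, oneCocycleClass_mem_subgroupResKer_iff]
    at hx
  obtain ⟨b, hb⟩ := hx
  refine ⟨(torsionBaseChangeEquiv L W n).symm b, fun σ => ?_⟩
  -- lift `σ ∈ I_𝔓` to `τ ∈ I_𝔔`
  obtain ⟨τ, hτ⟩ := hI σ.2
  have hτσ : absGaloisRestrict F L τ = (σ : absoluteGaloisGroup F) := hτ
  have hτI : τ ∈ 𝔔.inertia (absoluteGaloisGroup L) := by
    rw [← comap_inertia_comap_absIntegersMap F L 𝔔, Subgroup.mem_comap]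
    change absGaloisRestrict F L τ ∈ _
    rw [hτσ]
    exact σ.2
  have h := hb ⟨τ, hτI⟩
  rw [pullback_resHomOfEquivariant_apply] at h
  -- `h : θ (φ (res τ)) = τ • b - b`; transport back along `θ = torsionBaseChangeEquiv`
  have hσ : (σ : absoluteGaloisGroup F) = resGal (K := F) L τ := hτσ.symm
  have key : torsionBaseChangeEquiv L W n (φ.1 (σ : absoluteGaloisGroup F)) =
      torsionBaseChangeEquiv L W n ((σ : absoluteGaloisGroup F) • (torsionBaseChangeEquiv L W n).symm b -
        (torsionBaseChangeEquiv L W n).symm b) := by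
    rw [map_sub, AddEquiv.apply_symm_apply, hσ, torsionBaseChangeEquiv_apply,
      torsionBaseChangeEquiv_apply, torsionBaseChangeMap_smul,
      ← torsionBaseChangeEquiv_apply L W n ((torsionBaseChangeEquiv L W n).symm b),
      AddEquiv.apply_symm_apply]
    exact h
  exact (torsionBaseChangeEquiv L W n).injective key

end Summit.BirchSwinnertonDyer.BirchSwinnertonDyer.Theorems.GenusExact.SelmerDescent

end
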